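import Literature.Analysis.FluidPDE.AxisymNoSwirlL1VorticityGlobal
import Literature.Analysis.FluidPDE.ClassicalSolutionRescale
import Literature.Analysis.FluidPDE.EulerBlowupScaling
import HarnessLib

/-!
# Gallay–Šverák 2015: the `L¹(Ω)`-vorticity global existence statement at ARBITRARY viscosity
# `ν > 0` (change of time unit)

Analysis/FluidPDE support file (all results proved). The tree's
`GallaySverak2015.L1VorticityGlobalExistence.of_noSwirlDatum` turns the named fact
`GallaySverak2015.L1VorticityGlobalExistence` (Gallay–Šverák 2015, Thm 1.1, stated at viscosity
`ν = 1` as printed) into: every `C¹` axisymmetric swirl-free datum with compactly supported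
vorticity launches a global classical Navier–Stokes solution with viscosity `1`, axisymmetric and
swirl-free at all positive times, attaining the datum in the `L¹(Ω, dr dz)` vorticity norm and with
bounded vorticity on every `[0, T)`. The paper works at `ν = 1` "without loss of generality"
(arXiv:1510.01036, §1: the equation is normalised); this file supplies the normalisation step for
classical solutions: if `(u′, p′)` solves the system with viscosity `1`, then
`u(s, x) = ν u′(ν s, x)`, `p(s, x) = ν² p′(ν s, x)` (the tree's `timeRescale ν ν u′`,
`timeRescale ν (ν²) p′`) solves it with viscosity `ν` (`IsClassicalNSSolutionOn.stRescale` with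
`α = β = ν`, `γ = 1`), and every clause of the conclusion is transported along `s ↦ ν s`:
axisymmetry / no swirl (`IsAxisymmetric.const_smul`, `HasNoSwirl.const_smul`), the vorticity
(`curl_const_smul_field`), the `L¹(Ω)` norm (`l1OmegaNorm_const_smul`, proved here), and the
`limsup` blow-up predicate (`VorticityBlowsUpAt.timeRescale`). Net effect:
`GallaySverak2015.L1VorticityGlobalExistence.of_noSwirlDatum_viscosity` — the same conditional
statement at every `ν > 0` (consumer: the profile cell's Z6 ν-axis; HARVEST-MAP offer (e)).
No new named fact.

## References

* Th. Gallay, V. Šverák, *Remarks on the Cauchy problem for the axisymmetric Navier–Stokes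
  equations*, Confluentes Math. 7 (2015) 67–92 = arXiv:1510.01036, §1 (normalisation `ν = 1`),
  Thm 1.1. [GallaySverak2016]
* T. Tao, *Localisation and compactness properties of the Navier–Stokes global regularity
  problem*, Anal. PDE 6 (2013), footnote 3 (viscosity rescaling). [Tao2011]
-/

noncomputable section

open MeasureTheory Set Function Filter
open _root_.Topology
open scoped NNReal ENNReal

namespace Literature.Analysis.FluidPDE

/-! ### Scaling bookkeeping -/

/-- The `L¹(Ω, dr dz)` vorticity norm is absolutely homogeneous:
`‖a ω‖_{L¹(Ω)} = |a| ‖ω‖_{L¹(Ω)}`. [cite: GallaySverak2016, (1.5) (arXiv p. 4)] -/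
theorem GallaySverak2015.l1OmegaNorm_const_smul (a : ℝ)
    (ω : EuclideanSpace ℝ (Fin 3) → EuclideanSpace ℝ (Fin 3)) :
    GallaySverak2015.l1OmegaNorm (fun x => a • ω x) = ‖a‖ₑ * GallaySverak2015.l1OmegaNorm ω := by
  unfold GallaySverak2015.l1OmegaNorm
  rw [← lintegral_const_mul' _ _ (by simp)]
  refine lintegral_congr fun x => ?_
  rw [enorm_smul, mul_div_assoc]

/-- Undoing a time dilation: `timeRescale ν⁻¹ ν⁻¹ (timeRescale ν ν w) = w` for `ν ≠ 0`. [folklore] -/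
private theorem timeRescale_inv_timeRescale {ν : ℝ} (hν : ν ≠ 0)
    (w : ℝ → EuclideanSpace ℝ (Fin 3) → EuclideanSpace ℝ (Fin 3)) :
    timeRescale ν⁻¹ ν⁻¹ (timeRescale ν ν w) = w := by
  funext s x
  simp [timeRescale_apply, smul_smul, ← mul_assoc, inv_mul_cancel₀ hν, mul_inv_cancel₀ hν]

/-- For `ν > 0`, `t ↦ ν t` maps right neighbourhoods of `0` to right neighbourhoods of `0`. [folklore] -/
private theorem tendsto_viscosity_mul_nhdsGT_zero {ν : ℝ} (hν : 0 < ν) :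
    Tendsto (fun t : ℝ => ν * t) (𝓝[>] 0) (𝓝[>] 0) := by
  have hmaps : MapsTo (fun t : ℝ => ν * t) (Ioi 0) (Ioi 0) := fun t ht => mul_pos hν ht
  have hcont : ContinuousWithinAt (fun t : ℝ => ν * t) (Ioi 0) 0 :=
    (continuous_const_mul ν).continuousWithinAt
  have h := hcont.tendsto_nhdsWithin hmaps
  rwa [mul_zero] at h

/-- **Viscosity change for classical solutions on `(0, ∞)`**: if `(u′, p′)` solves the unforced
Navier–Stokes system with viscosity `1` classically on `(0, ∞) × ℝ³`, then
`u(s) = ν u′(ν s)`, `p(s) = ν² p′(ν s)` solve it with viscosity `ν > 0` on `(0, ∞) × ℝ³`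
(`IsClassicalNSSolutionOn.stRescale`, `α = β = ν`, `γ = 1`). [cite: Tao2011, footnote 3] -/
theorem IsClassicalNSSolutionOn.timeRescale_viscosity_Ioi {ν : ℝ} (hν : 0 < ν)
    {u' : ℝ → EuclideanSpace ℝ (Fin 3) → EuclideanSpace ℝ (Fin 3)}
    {p' : ℝ → EuclideanSpace ℝ (Fin 3) → ℝ} (h : IsClassicalNSSolutionOn (Ioi 0) 1 0 u' p') :
    IsClassicalNSSolutionOn (Ioi 0) ν 0 (timeRescale ν ν u') (timeRescale ν (ν ^ 2) p') := by
  have hres := h.stRescale (α := ν) (β := ν) (γ := 1) hν one_pos (by ring) 0 0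
  have hS : ((fun r : ℝ => 0 + ν * r) ⁻¹' Ioi 0) = Ioi 0 := by
    ext r
    simp only [mem_preimage, mem_Ioi, zero_add]
    exact ⟨fun hr => pos_of_mul_pos_right hr hν.le, fun hr => mul_pos hν hr⟩
  have hu : ν • stPull ν 1 0 0 u' = timeRescale ν ν u' := by
    funext s y
    simp [stPull_apply, timeRescale_apply]
  have hp : ν ^ 2 • stPull ν 1 0 0 p' = timeRescale ν (ν ^ 2) p' := by
    funext s y
    simp [stPull_apply, timeRescale_apply]
  rw [hS, hu, hp, smul_stPull_zero, show ν * 1 / 1 = ν by ring] at hres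
  exact hres

namespace GallaySverak2015

/-- **Gallay–Šverák 2015, Thm 1.1 for smooth swirl-free data, at every viscosity `ν > 0`**
(the ν-general form of `L1VorticityGlobalExistence.of_noSwirlDatum`; still conditional on the
named fact `L1VorticityGlobalExistence`). For `ν > 0` and a `C¹` axisymmetric swirl-free datum
`u₀` on `ℝ³` with compactly supported vorticity there is a global classical solution `(u, p)` of
the unforced Navier–Stokes system with viscosity `ν` on `(0, ∞) × ℝ³`, axisymmetric and swirl-free
at all positive times, whose vorticity attains `curl u₀` in `L¹(Ω, dr dz)` as `t ↓ 0`, and whose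
vorticity does not blow up at any finite time. Proof: apply the `ν = 1` statement to the datum
`ν⁻¹ u₀` and set `u(s) = ν u′(ν s)`, `p(s) = ν² p′(ν s)` (the paper's normalisation, §1).
[cite: GallaySverak2016, Theorem 1.1 and §1 normalisation ν = 1 (arXiv:1510.01036 pp. 2–4)] -/
theorem L1VorticityGlobalExistence.of_noSwirlDatum_viscosity (h : L1VorticityGlobalExistence)
    {ν : ℝ} (hν : 0 < ν)
    {u₀ : EuclideanSpace ℝ (Fin 3) → EuclideanSpace ℝ (Fin 3)} (hu : ContDiff ℝ 1 u₀)
    (hax : IsAxisymmetric u₀) (hsw : HasNoSwirl u₀) (hK : HasCompactSupport (curl u₀)) :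
    ∃ (u : ℝ → EuclideanSpace ℝ (Fin 3) → EuclideanSpace ℝ (Fin 3))
      (p : ℝ → EuclideanSpace ℝ (Fin 3) → ℝ),
      IsClassicalNSSolutionOn (Ioi 0) ν 0 u p ∧
      (∀ t, 0 < t → IsAxisymmetric (u t) ∧ HasNoSwirl (u t)) ∧
      Tendsto (fun t => l1OmegaNorm (fun x => curl (u t) x - curl u₀ x)) (𝓝[>] 0) (𝓝 0) ∧
      ∀ T, 0 < T → ¬ VorticityBlowsUpAt u T := by
  have hν0 : ν ≠ 0 := hν.ne'
  -- the rescaled datum `ν⁻¹ u₀`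
  set v₀ : EuclideanSpace ℝ (Fin 3) → EuclideanSpace ℝ (Fin 3) := fun x => ν⁻¹ • u₀ x with hv₀
  have hv : ContDiff ℝ 1 v₀ := hu.const_smul ν⁻¹
  have hvax : IsAxisymmetric v₀ := hax.const_smul ν⁻¹
  have hvsw : HasNoSwirl v₀ := hsw.const_smul ν⁻¹
  have hcurlv : curl v₀ = fun x => ν⁻¹ • curl u₀ x := funext fun x => curl_const_smul_field ν⁻¹ u₀ x
  have hvK : HasCompactSupport (curl v₀) := by
    rw [hcurlv]
    exact hK.mono fun x hx h0 => hx (by simp [h0])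
  -- the `ν = 1` solution from the rescaled datum
  obtain ⟨u', p', hsol', hsym', hcont', hnb'⟩ := h.of_noSwirlDatum hv hvax hvsw hvK
  refine ⟨timeRescale ν ν u', timeRescale ν (ν ^ 2) p', hsol'.timeRescale_viscosity_Ioi hν,
    ?_, ?_, ?_⟩
  · -- axisymmetric and swirl-free slices
    intro t ht
    have hνt : 0 < ν * t := mul_pos hν ht
    rw [timeRescale_slice]
    exact ⟨(hsym' (ν * t) hνt).1.const_smul ν, (hsym' (ν * t) hνt).2.const_smul ν⟩
  · -- `L¹(Ω)` continuity of the vorticity at `t = 0⁺`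
    have hdiff : ∀ t, (fun x => curl (timeRescale ν ν u' t) x - curl u₀ x) =
        fun x => ν • (curl (u' (ν * t)) x - curl v₀ x) := by
      intro t
      funext x
      rw [timeRescale_slice, curl_const_smul_field, hcurlv, smul_sub, smul_smul,
        mul_inv_cancel₀ hν0, one_smul]
    simp_rw [hdiff, l1OmegaNorm_const_smul]
    have hcomp := hcont'.comp (tendsto_viscosity_mul_nhdsGT_zero hν)
    have := ENNReal.Tendsto.const_mul hcomp (Or.inr (by simp : ‖ν‖ₑ ≠ ⊤))
    simpa using this
  · -- no finite-time vorticity blow-up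
    intro T hT hblow
    have h1 := hblow.timeRescale (c := ν⁻¹) (inv_pos.2 hν)
    rw [timeRescale_inv_timeRescale hν0, div_inv_eq_mul] at h1
    exact hnb' (T * ν) (mul_pos hT hν) h1

end GallaySverak2015

end Literature.Analysis.FluidPDE
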